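import Summits.CriticalPhenomena.SAWScalingLimit.Theorems.SAWDevelopingMapObservableToSLETypeLadderCarvedReductionSqueezeSpineLimits
import HarnessLib

/-!
# Limits of pinned FAT SETS (spines, bodies) along a subsequence — general radius and extra clauses
# (piece (T-A lim-d) of stub T-A `stub_carvedReduction_squeezeGeometry`)

Crux `SAWDevelopingMap.ObservableToSLE` (stmt-CriticalPhenomena-10472), line `six-class-type-ladder`,
stub T-A `stub_carvedReduction_squeezeGeometry`.  Landing target:
`Summits/CriticalPhenomena/SAWScalingLimit/Theorems/SAWDevelopingMapObservableToSLETypeLadderCarvedReductionSqueezeFatLimits.lean`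
(`--supports stmt-CriticalPhenomena-10472`).  Generalisation of `…SqueezeSpineLimits` (`spine_limits`:
radius `ρ/8`, dipping clause built in) for ALL the fat compact connected sets of the solid families:
the fat SPINES (radius `ρ/8`, through the root), the fat BODIES under the windows (radius `ρ/4`,
through the root AND the body point `δ c_q - (ρ/2) i` below the gate — the corridor of the window
cross-cuts of the super-domain runs from the dock bottoms through the body core to the root), with
any extra per-index clause `P j K` carried along (dipping, extra marked points):
* `fat_limits` — along a subsequence the pinned fat sets (radius `r₀ > 0` removed neighbourhood)
  converge in the Hausdorff metric to a compact connected limit through the limit pinned root, inside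
  a fixed disc, the core `{infDist · Kinf ≤ r₀ - ε}` is persistently removed, the chosen sets satisfy
  the extra clause, and limits of convergent marked points of the pinned sets lie in the limit
  (`mem_fatLimit_of_tendsto`).
Registered carrier: `stub_carvedReduction_hausdorffEDist_ne_top`.
-/

noncomputable section

open scoped Topology
open Filter Set Metric TopologicalSpace
open Literature.Probability.LatticeModels (HexVertex hexGraph hexCenter Site)
open Literature.Probability.RandomPlanarGeometry
open Literature.Probability.Percolation.QuadCrossing (mem_of_tendsto_of_hausdorffDist_tendsto
  isPreconnected_of_hausdorffDist_tendsto)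

namespace Summit.CriticalPhenomena.SAWScalingLimit.Theorems.ObservableToSLE.TypeLadder

open Summit.CriticalPhenomena.SAWScalingLimit.Theorems.ObservableToSLER.BridgeGate
open Summit.CriticalPhenomena.SAWScalingLimit.Theorems.ObservableToSLE.FloorRatio (exists_vertex_dist_le)

/-! ### Finite Hausdorff edistance, membership of limits -/

/-- Nonempty bounded sets are at finite Hausdorff edistance. -/
theorem hausdorffEDist_ne_top_of_isCompact {A B : Set ℂ} (hA : IsCompact A) (hB : IsCompact B)
    (hAn : A.Nonempty) (hBn : B.Nonempty) : hausdorffEDist A B ≠ ⊤ :=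
  hausdorffEDist_ne_top_of_nonempty_of_bounded hAn hBn hA.isBounded hB.isBounded

/-- **Registered sub-goal `stub_carvedReduction_hausdorffEDist_ne_top`** (crux item
stmt-CriticalPhenomena-10472, stub T-A `stub_carvedReduction_squeezeGeometry`, piece (T-A lim-d)). -/
theorem stub_carvedReduction_hausdorffEDist_ne_top :
    ∀ (A B : Set ℂ), IsCompact A → IsCompact B → A.Nonempty → B.Nonempty → hausdorffEDist A B ≠ ⊤ :=
  fun _ _ hA hB hAn hBn => hausdorffEDist_ne_top_of_isCompact hA hB hAn hBn

/-- **Limits of marked points of Hausdorff-convergent compact sets lie in the limit.** -/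
theorem mem_fatLimit_of_tendsto {Kp : ℕ → Set ℂ} {Kinf : Set ℂ} (hKp : ∀ j, IsCompact (Kp j) ∧ (Kp j).Nonempty)
    (hKinf : IsCompact Kinf) (hne : Kinf.Nonempty)
    (hH : Tendsto (fun j => hausdorffDist (Kp j) Kinf) atTop (𝓝 0)) {y : ℕ → ℂ} {y₀ : ℂ}
    (hy : ∀ j, y j ∈ Kp j) (hlim : Tendsto y atTop (𝓝 y₀)) : y₀ ∈ Kinf :=
  mem_of_tendsto_of_hausdorffDist_tendsto hKinf.isClosed hne
    (fun j => hausdorffEDist_ne_top_of_isCompact (hKp j).1 hKinf (hKp j).2 hne) hH hy hlim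

/-! ### The limits -/

/-- **LIMITS OF PINNED FAT SETS**; see the module docstring.  Hypotheses: meshes `s j > 0`, `s j → 0`;
levels `L j`, `R`-local about `root j`; fat sets `K` (compact, connected, through the rescaled root,
closed `r₀`-neighbourhood removed at vertex level, `r₀ > 0`) satisfying an extra clause `P j K`; pinned
roots `s_j c_{root j} - τ j → ℓ₀`.  Conclusion: a subsequence `ψ`, the chosen fat sets `Ko j` (original
frame, satisfying `P`), their pinned images `Kp j` converging in the Hausdorff metric to a compact
connected `Kinf ∋ ℓ₀` inside `closedBall ℓ₀ (R + 1)`, and the persistence of the core. -/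
theorem fat_limits {s : ℕ → ℝ} {τ : ℕ → ℂ} {L : ℕ → Set HexVertex} {root : ℕ → HexVertex}
    {R r₀ : ℝ} {ℓ₀ : ℂ} {P : ℕ → Set ℂ → Prop} (hr₀ : 0 < r₀) (hspos : ∀ j, 0 < s j)
    (hs0 : Tendsto s atTop (𝓝 0))
    (hloc : ∀ j, ∀ v ∈ L j, dist ((s j : ℂ) * hexCenter v) ((s j : ℂ) * hexCenter (root j)) ≤ R)
    (hfat : ∀ j, ∃ K : Set ℂ, IsCompact K ∧ IsConnected K ∧ (s j : ℂ) * hexCenter (root j) ∈ K ∧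
      (∀ v : HexVertex, infDist ((s j : ℂ) * hexCenter v) K ≤ r₀ → v ∈ L j) ∧ P j K)
    (hrootlim : Tendsto (fun j => (s j : ℂ) * hexCenter (root j) - τ j) atTop (𝓝 ℓ₀)) :
    ∃ (ψ : ℕ → ℕ) (Kinf : Set ℂ) (Ko Kp : ℕ → Set ℂ), StrictMono ψ ∧
      IsCompact Kinf ∧ IsConnected Kinf ∧ ℓ₀ ∈ Kinf ∧ Kinf ⊆ closedBall ℓ₀ (R + 1) ∧
      (∀ j, Kp j = (fun w : ℂ => w - τ (ψ j)) '' Ko j ∧ IsCompact (Ko j) ∧ IsConnected (Ko j) ∧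
        (s (ψ j) : ℂ) * hexCenter (root (ψ j)) ∈ Ko j ∧
        (∀ v : HexVertex, infDist ((s (ψ j) : ℂ) * hexCenter v) (Ko j) ≤ r₀ → v ∈ L (ψ j)) ∧ P (ψ j) (Ko j)) ∧
      (∀ j, IsCompact (Kp j) ∧ IsConnected (Kp j) ∧
        (s (ψ j) : ℂ) * hexCenter (root (ψ j)) - τ (ψ j) ∈ Kp j ∧ Kp j ⊆ closedBall ℓ₀ (R + 1) ∧
        (∀ v : HexVertex, infDist ((s (ψ j) : ℂ) * hexCenter v - τ (ψ j)) (Kp j) ≤ r₀ → v ∈ L (ψ j))) ∧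
      Tendsto (fun j => hausdorffDist (Kp j) Kinf) atTop (𝓝 0) ∧
      (∀ ε > (0 : ℝ), ∀ᶠ j in atTop, ∀ v : HexVertex,
        infDist ((s (ψ j) : ℂ) * hexCenter v - τ (ψ j)) Kinf ≤ r₀ - ε → v ∈ L (ψ j)) := by
  classical
  choose K hKc hKconn hKroot hKfat hKP using hfat
  -- the pinned spines
  set Kq : ℕ → Set ℂ := fun j => (fun w : ℂ => w - τ j) '' K j with hKq
  have hKqc : ∀ j, IsCompact (Kq j) := fun j => (hKc j).image (continuous_id.sub continuous_const)
  have hKqconn : ∀ j, IsConnected (Kq j) := fun j => (hKconn j).image _ (continuous_id.sub continuous_const).continuousOn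
  have hKqroot : ∀ j, (s j : ℂ) * hexCenter (root j) - τ j ∈ Kq j := fun j => ⟨_, hKroot j, rfl⟩
  have hKqfat : ∀ j (v : HexVertex), infDist ((s j : ℂ) * hexCenter v - τ j) (Kq j) ≤ r₀ → v ∈ L j := by
    intro j v hv
    rw [hKq] at hv; simp only at hv; rw [infDist_sub_image] at hv
    exact hKfat j v hv
  -- the pinned spines lie in a fixed disc, eventually
  have hsmall : ∀ᶠ j in atTop, s j < min r₀ (1 / 2) := (tendsto_order.1 hs0).2 _ (lt_min hr₀ (by norm_num))
  have hrootnear : ∀ᶠ j in atTop, dist ((s j : ℂ) * hexCenter (root j) - τ j) ℓ₀ < 1 / 2 :=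
    (tendsto_iff_dist_tendsto_zero.1 hrootlim).eventually (gt_mem_nhds (by norm_num))
  have hdisc : ∀ᶠ j in atTop, Kq j ⊆ closedBall ℓ₀ (R + 1) := by
    filter_upwards [hsmall, hrootnear] with j hsj hrj z hz
    obtain ⟨z₀, hz₀, rfl⟩ := hz
    obtain ⟨v, hv⟩ := exists_vertex_dist_le (hspos j) z₀
    have hvL : v ∈ L j := by
      refine hKfat j v ((infDist_le_dist_of_mem hz₀).trans (hv.trans ?_))
      linarith [hsj.trans_le (min_le_left _ _)]
    have h1 := hloc j v hvL
    rw [mem_closedBall]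
    calc dist (z₀ - τ j) ℓ₀ ≤ dist (z₀ - τ j) ((s j : ℂ) * hexCenter (root j) - τ j) +
          dist ((s j : ℂ) * hexCenter (root j) - τ j) ℓ₀ := dist_triangle _ _ _
      _ = dist z₀ ((s j : ℂ) * hexCenter (root j)) + dist ((s j : ℂ) * hexCenter (root j) - τ j) ℓ₀ := by
          rw [dist_sub_right]
      _ ≤ (dist z₀ ((s j : ℂ) * hexCenter v) + dist ((s j : ℂ) * hexCenter v) ((s j : ℂ) * hexCenter (root j))) +
          dist ((s j : ℂ) * hexCenter (root j) - τ j) ℓ₀ := add_le_add (dist_triangle _ _ _) le_rfl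
      _ ≤ (s j + R) + 1 / 2 := by
          refine add_le_add (add_le_add ?_ h1) hrj.le
          rw [dist_comm]; exact hv
      _ ≤ R + 1 := by linarith [hsj.trans_le (min_le_right _ _)]
  obtain ⟨j₀, hj₀⟩ := eventually_atTop.1 hdisc
  -- Blaschke selection for the shifted sequence
  set F : ℕ → Fin 1 → NonemptyCompacts ℂ := fun j _ =>
    ⟨⟨Kq (j₀ + j), hKqc (j₀ + j)⟩, ⟨_, hKqroot (j₀ + j)⟩⟩ with hF
  have hFK : ∀ j i, ((F j i : Set ℂ)) ⊆ closedBall ℓ₀ (R + 1) := fun j _ => hj₀ (j₀ + j) (by omega)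
  obtain ⟨ψ₁, Lim, hψ₁, hLim, hconv⟩ :=
    exists_subseq_tendsto_nonemptyCompacts_pi (isCompact_closedBall ℓ₀ (R + 1)) F hFK
  have hH := tendsto_hausdorffDist_of_tendsto hconv 0
  set Kinf : Set ℂ := (Lim 0 : Set ℂ) with hKinf
  have hFeq : ∀ j, ((F (ψ₁ j) 0 : Set ℂ)) = Kq (j₀ + ψ₁ j) := fun j => rfl
  simp_rw [hFeq] at hH
  have hfin : ∀ j, hausdorffEDist (Kq (j₀ + ψ₁ j)) Kinf ≠ ⊤ := fun j =>
    hausdorffEDist_ne_top_nonemptyCompacts (F (ψ₁ j) 0) (Lim 0)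
  -- the subsequence
  set ψ : ℕ → ℕ := fun j => j₀ + ψ₁ j with hψdef
  have hψ : StrictMono ψ := fun a b hab => by simp only [hψdef]; exact Nat.add_lt_add_left (hψ₁ hab) _
  -- the limit spine
  have hKinfc : IsCompact Kinf := (Lim 0).isCompact
  have hℓ₀ : ℓ₀ ∈ Kinf :=
    mem_of_tendsto_of_hausdorffDist_tendsto hKinfc.isClosed (Lim 0).nonempty hfin hH
      (fun j => hKqroot (j₀ + ψ₁ j)) (hrootlim.comp hψ.tendsto_atTop)
  have hKinfconn : IsConnected Kinf :=
    ⟨⟨ℓ₀, hℓ₀⟩, isPreconnected_of_hausdorffDist_tendsto hKinfc (fun j => (hKqconn (j₀ + ψ₁ j)).isPreconnected) hfin hH⟩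
  refine ⟨ψ, Kinf, fun j => K (ψ j), fun j => Kq (ψ j), hψ, hKinfc, hKinfconn, hℓ₀, hLim 0,
    fun j => ⟨rfl, hKc _, hKconn _, hKroot _, hKfat _, hKP _⟩,
    fun j => ⟨hKqc _, hKqconn _, hKqroot _, hj₀ _ (by simp only [hψdef]; omega), hKqfat _⟩, hH, fun ε hε => ?_⟩
  -- persistence of the core
  have hev : ∀ᶠ j in atTop, hausdorffDist (Kq (j₀ + ψ₁ j)) Kinf < ε := (tendsto_order.1 hH).2 ε hε
  filter_upwards [hev] with j hj v hv
  refine hKqfat (ψ j) v ?_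
  have h1 := infDist_le_infDist_add_hausdorffDist (x := (s (ψ j) : ℂ) * hexCenter v - τ (ψ j))
    (s := Kinf) (t := Kq (j₀ + ψ₁ j)) (by rw [hausdorffEDist_comm]; exact hfin j)
  rw [hausdorffDist_comm] at h1
  change infDist ((s (ψ j) : ℂ) * hexCenter v - τ (ψ j)) (Kq (j₀ + ψ₁ j)) ≤ r₀
  linarith

end Summit.CriticalPhenomena.SAWScalingLimit.Theorems.ObservableToSLE.TypeLadder

end
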